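import Mathlib
import HarnessLib

/-!
# Route `KLProgramme` — crux C4a, S3 (B4)-(T) — FOLD-WINDOW CALCULUS, part 1 («(B4)-TAN-FOLD», SUBLEVEL GEOMETRY AND THE WINDOW LAW):
# under `a·φ² − C|φ|³ − η ≤ |g φ|` on `|φ| ≤ φ₀` (`C·φ₀ ≤ a/2`) the crossing region `{|g| ≤ ε}` lies in `[−ℓ, ℓ]`, `ℓ = √(2(ε+η)/a)`,
# has measure `≤ 2ℓ`, and `‖∫_s w φ • Ψ(g φ) dφ‖ ≤ W·M·2ℓ` for `Ψ` supported in `|y| ≤ ε`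

Cell `gate-hubbard-kl`, seat hubbard-kl-k3c3-p3 (g21; row «implicit-function / monotonicity route»).  Located brick for the (C)-closer lane c4a-1
(stub (C) `stub_twoLeg_curvature` of `KLRegimeEngineV17F2`, stmt-HubbardSuperconductivity-20437), C4A-PLAN §24.4 (power counting near the TANGENCY
configuration (T): «crossing region of measure `2^{−J/2}`») and §24.9 («the crossing-region input of §24.4: `{|ē| ≲ 2^{−J}} ⊂ {φ² ≲ 2^{−J} + |e| + δ}`,
measure `≲ 2^{−J/2}`»).  Near (T) the partner band `φ ↦ ē(e,φ;ρ,ϑ,θ)` has a nondegenerate critical point — a FOLD, `ē ≈ b_T(θ)·φ² − e` — so the loop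
angle is NOT a chart of the partner level on the whole window (the monotone-window calculus `…C4aLoopIBPBounds` does not apply); what the absolute count
near (T) consumes instead is the geometry of the sublevel sets of a function bounded below by a model fold.  The INPUT is exactly the landed two-sided value
`…C4aPartnerBandTangencyLower.partnerBand_pp/ph_tangency_lower`: `a·φ² − C·|φ|³ − η ≤ |ē|` with `a = (3/200)·u_min²`,
`C = K₃D₁³ + 3K₂D₁D₂ + K₁D₃`, `η = K₁|e|/d + K₁(|ρ|/d + D₁|ϑ − ϑ_T|)` (the instance is `…C4aFoldWindowPartnerBand`).

* §1 SUBLEVEL GEOMETRY (no derivatives): on the window `|φ| ≤ φ₀` with `C·φ₀ ≤ a/2` the cubic is absorbed, `a/2·φ² − η ≤ |g φ|` (`fold_lower_half`);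
  hence **`sq_le_of_fold_lower`** `|g φ| ≤ ε ⟹ φ² ≤ 2(ε+η)/a`, **`abs_le_sqrt_of_fold_lower`** `|φ| ≤ ℓ := √(2(ε+η)/a)`,
  **`fold_sublevel_subset_Icc`** `{|φ| ≤ φ₀ ∧ |g φ| ≤ ε} ⊆ [−ℓ, ℓ]`, **`volume_fold_sublevel_le`** `vol ≤ 2ℓ` — the `2^{−J/2}` of §24.4 at `ε = 2^{−J}`,
  `|e|, δ ≲ 2^{−J}`;
* §2 THE WINDOW LAW: for `Ψ : ℝ → E` with `Ψ y = 0` when `ε < |y|` and `‖Ψ y‖ ≤ M`, a weight `w` vanishing off the window whose bound `|w φ| ≤ W` is asked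
  ONLY ON THE CROSSING REGION (`|φ| ≤ φ₀ ∧ φ² ≤ 2(ε+η)/a` — this is where the anisotropy factors `|𝒜| ≲ |e| + φ² + δ` of §24.4 are read):
  **`norm_smul_comp_le_indicator_fold`** (pointwise), **`norm_setIntegral_smul_comp_le_fold`** `‖∫_s w φ • Ψ(g φ)‖ ≤ W·M·2ℓ` for every set `s`
  (the consumer's `∫ φ in Ioo (−π) π` after a partition of unity), **`norm_intervalIntegral_smul_comp_le_fold`** (interval currency);
* §3 LAYERED SHELLS: `‖Ψ y‖ ≤ Σ_{j<N} M_j·𝟙{|y| ≤ ε_j}` ⟹ `‖∫_s w • Ψ(g)‖ ≤ W · Σ_j M_j·2√(2(ε_j+η)/a)` (**`norm_setIntegral_smul_comp_le_fold_layered`**) —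
  tails of a slice function as a sum of shells.

Carrier-free (`g, w : ℝ → ℝ`, `Ψ : ℝ → E`); nothing is asserted about the Hubbard model.  Part 2 (`…C4aFoldSubstitution`) is the C² fold: energy inequality,
the sharp level-set law and the fold substitution (the square-root law of §24.2 in level currency).
References: FST II, CPAM 51 (1998) §3 [cite: FeldmanSalmhoferTrubowitz1998]; BGM 2006 §2.4 [cite: BenfattoGiulianiMastropietro2006].
-/

noncomputable section

namespace Summit.HubbardSuperconductivity.HubbardSuperconductivity.Theorems.C4a

set_option linter.dupNamespace false -- summit = problem name (single-conjunct summit), D-0017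

open Real Set Filter MeasureTheory intervalIntegral Finset
open scoped Topology ENNReal

variable {E : Type*} [NormedAddCommGroup E] [NormedSpace ℝ E]

/-! ## §1 Sublevel geometry of a function bounded below by a model fold -/

section Sublevel

variable {g : ℝ → ℝ} {a C η φ₀ ε : ℝ}

/-- On the window `|φ| ≤ φ₀` with `C·φ₀ ≤ a/2` the cubic error is absorbed by half the curvature: `a/2·φ² − η ≤ |g φ|`. [folklore] -/
theorem fold_lower_half (hC : 0 ≤ C) (hwin : C * φ₀ ≤ a / 2)
    (hlow : ∀ φ, |φ| ≤ φ₀ → a * φ ^ 2 - C * |φ| ^ 3 - η ≤ |g φ|) {φ : ℝ} (hφ : |φ| ≤ φ₀) :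
    a / 2 * φ ^ 2 - η ≤ |g φ| := by
  have h1 := hlow φ hφ
  have h2 : C * |φ| ^ 3 ≤ a / 2 * φ ^ 2 := by
    have e3 : |φ| ^ 3 = |φ| * φ ^ 2 := by rw [pow_succ', sq_abs]
    rw [e3, ← mul_assoc]
    exact mul_le_mul_of_nonneg_right ((mul_le_mul_of_nonneg_left hφ hC).trans hwin) (sq_nonneg φ)
  linarith

/-- **THE CROSSING REGION IS A SMALL ANGLE**: `|φ| ≤ φ₀`, `|g φ| ≤ ε` ⟹ `φ² ≤ 2(ε + η)/a`. [folklore] -/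
theorem sq_le_of_fold_lower (ha : 0 < a) (hC : 0 ≤ C) (hwin : C * φ₀ ≤ a / 2)
    (hlow : ∀ φ, |φ| ≤ φ₀ → a * φ ^ 2 - C * |φ| ^ 3 - η ≤ |g φ|) {φ : ℝ} (hφ : |φ| ≤ φ₀) (hε : |g φ| ≤ ε) :
    φ ^ 2 ≤ 2 * (ε + η) / a := by
  have h := fold_lower_half hC hwin hlow hφ
  rw [le_div_iff₀ ha]
  nlinarith

/-- The same as a bound on `|φ|`: `|φ| ≤ ℓ := √(2(ε + η)/a)`. [folklore] -/
theorem abs_le_sqrt_of_fold_lower (ha : 0 < a) (hC : 0 ≤ C) (hwin : C * φ₀ ≤ a / 2)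
    (hlow : ∀ φ, |φ| ≤ φ₀ → a * φ ^ 2 - C * |φ| ^ 3 - η ≤ |g φ|) {φ : ℝ} (hφ : |φ| ≤ φ₀) (hε : |g φ| ≤ ε) :
    |φ| ≤ Real.sqrt (2 * (ε + η) / a) := by
  rw [← Real.sqrt_sq_eq_abs]
  exact Real.sqrt_le_sqrt (sq_le_of_fold_lower ha hC hwin hlow hφ hε)

/-- **SUBLEVEL INCLUSION**: `{φ : |φ| ≤ φ₀ ∧ |g φ| ≤ ε} ⊆ [−ℓ, ℓ]`, `ℓ = √(2(ε + η)/a)`. [folklore] -/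
theorem fold_sublevel_subset_Icc (ha : 0 < a) (hC : 0 ≤ C) (hwin : C * φ₀ ≤ a / 2)
    (hlow : ∀ φ, |φ| ≤ φ₀ → a * φ ^ 2 - C * |φ| ^ 3 - η ≤ |g φ|) (ε : ℝ) :
    {φ : ℝ | |φ| ≤ φ₀ ∧ |g φ| ≤ ε} ⊆ Icc (-Real.sqrt (2 * (ε + η) / a)) (Real.sqrt (2 * (ε + η) / a)) :=
  fun _ hφ => abs_le.1 (abs_le_sqrt_of_fold_lower ha hC hwin hlow hφ.1 hφ.2)

/-- **MEASURE OF THE CROSSING REGION**: `vol {φ : |φ| ≤ φ₀ ∧ |g φ| ≤ ε} ≤ 2·√(2(ε + η)/a)` (no measurability of `g` needed). [folklore] -/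
theorem volume_fold_sublevel_le (ha : 0 < a) (hC : 0 ≤ C) (hwin : C * φ₀ ≤ a / 2)
    (hlow : ∀ φ, |φ| ≤ φ₀ → a * φ ^ 2 - C * |φ| ^ 3 - η ≤ |g φ|) (ε : ℝ) :
    volume {φ : ℝ | |φ| ≤ φ₀ ∧ |g φ| ≤ ε} ≤ ENNReal.ofReal (2 * Real.sqrt (2 * (ε + η) / a)) := by
  refine (measure_mono (fold_sublevel_subset_Icc ha hC hwin hlow ε)).trans ?_
  rw [Real.volume_Icc]
  exact le_of_eq (by congr 1; ring)

/-- Real-valued form of the measure bound. [folklore] -/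
theorem volume_real_fold_sublevel_le (ha : 0 < a) (hC : 0 ≤ C) (hwin : C * φ₀ ≤ a / 2)
    (hlow : ∀ φ, |φ| ≤ φ₀ → a * φ ^ 2 - C * |φ| ^ 3 - η ≤ |g φ|) (ε : ℝ) :
    (volume {φ : ℝ | |φ| ≤ φ₀ ∧ |g φ| ≤ ε}).toReal ≤ 2 * Real.sqrt (2 * (ε + η) / a) :=
  ENNReal.toReal_le_of_le_ofReal (by positivity) (volume_fold_sublevel_le ha hC hwin hlow ε)

end Sublevel

/-! ## §2 The window law: a tangency-window term is priced by the measure of the crossing region -/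

section Window

variable {g w : ℝ → ℝ} {a C η φ₀ ε M W : ℝ} {Ψ : ℝ → E}

/-- Pointwise domination: on the whole line, `‖w φ • Ψ(g φ)‖ ≤ (W·M)·𝟙_{[−ℓ,ℓ]}(φ)` when `w` vanishes off the window, `Ψ` vanishes off `|y| ≤ ε`,
`‖Ψ‖ ≤ M`, and `|w| ≤ W` on the crossing region. [folklore] -/
theorem norm_smul_comp_le_indicator_fold (ha : 0 < a) (hC : 0 ≤ C) (hwin : C * φ₀ ≤ a / 2)
    (hlow : ∀ φ, |φ| ≤ φ₀ → a * φ ^ 2 - C * |φ| ^ 3 - η ≤ |g φ|)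
    (hΨ0 : ∀ y, ε < |y| → Ψ y = 0) (hΨM : ∀ y, ‖Ψ y‖ ≤ M) (hM : 0 ≤ M)
    (hw0 : ∀ φ, φ₀ < |φ| → w φ = 0) (hwW : ∀ φ, |φ| ≤ φ₀ → φ ^ 2 ≤ 2 * (ε + η) / a → |w φ| ≤ W) (hW : 0 ≤ W) (φ : ℝ) :
    ‖w φ • Ψ (g φ)‖ ≤ (Icc (-Real.sqrt (2 * (ε + η) / a)) (Real.sqrt (2 * (ε + η) / a))).indicator (fun _ => W * M) φ := by
  have hnn : 0 ≤ (Icc (-Real.sqrt (2 * (ε + η) / a)) (Real.sqrt (2 * (ε + η) / a))).indicator (fun _ => W * M) φ :=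
    Set.indicator_nonneg (fun _ _ => mul_nonneg hW hM) _
  by_cases hφ : |φ| ≤ φ₀
  · by_cases hε : |g φ| ≤ ε
    · have hsq := sq_le_of_fold_lower ha hC hwin hlow hφ hε
      have hmem : φ ∈ Icc (-Real.sqrt (2 * (ε + η) / a)) (Real.sqrt (2 * (ε + η) / a)) :=
        abs_le.1 (abs_le_sqrt_of_fold_lower ha hC hwin hlow hφ hε)
      rw [Set.indicator_of_mem hmem, norm_smul, Real.norm_eq_abs]
      exact mul_le_mul (hwW φ hφ hsq) (hΨM _) (norm_nonneg _) hW
    · rw [hΨ0 _ (not_le.1 hε), smul_zero, norm_zero]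
      exact hnn
  · rw [hw0 _ (not_le.1 hφ), zero_smul, norm_zero]
    exact hnn

/-- The indicator majorant is integrable for every restricted Lebesgue measure. -/
theorem integrable_indicator_Icc_const_restrict (ℓ c : ℝ) (s : Set ℝ) :
    Integrable ((Icc (-ℓ) ℓ).indicator fun _ : ℝ => c) (volume.restrict s) := by
  have h : Integrable ((Icc (-ℓ) ℓ).indicator fun _ : ℝ => c) (volume : Measure ℝ) := by
    rw [integrable_indicator_iff measurableSet_Icc]
    exact (continuous_const.continuousOn).integrableOn_compact isCompact_Icc
  exact h.mono_measure Measure.restrict_le_self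

/-- **THE WINDOW LAW (set-integral currency)**: under the fold lower bound on the window, `Ψ` supported in `|y| ≤ ε` with `‖Ψ‖ ≤ M`, and a weight
vanishing off the window with `|w| ≤ W` on the crossing region, `‖∫_s w φ • Ψ(g φ) dφ‖ ≤ W·M·2√(2(ε + η)/a)` for EVERY set `s`. [folklore] -/
theorem norm_setIntegral_smul_comp_le_fold (ha : 0 < a) (hC : 0 ≤ C) (hwin : C * φ₀ ≤ a / 2)
    (hlow : ∀ φ, |φ| ≤ φ₀ → a * φ ^ 2 - C * |φ| ^ 3 - η ≤ |g φ|)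
    (hΨ0 : ∀ y, ε < |y| → Ψ y = 0) (hΨM : ∀ y, ‖Ψ y‖ ≤ M) (hM : 0 ≤ M)
    (hw0 : ∀ φ, φ₀ < |φ| → w φ = 0) (hwW : ∀ φ, |φ| ≤ φ₀ → φ ^ 2 ≤ 2 * (ε + η) / a → |w φ| ≤ W) (hW : 0 ≤ W) (s : Set ℝ) :
    ‖∫ φ in s, w φ • Ψ (g φ)‖ ≤ W * M * (2 * Real.sqrt (2 * (ε + η) / a)) := by
  set ℓ := Real.sqrt (2 * (ε + η) / a) with hℓ
  have hℓ0 : 0 ≤ ℓ := Real.sqrt_nonneg _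
  have hpt := norm_smul_comp_le_indicator_fold ha hC hwin hlow hΨ0 hΨM hM hw0 hwW hW
  calc ‖∫ φ in s, w φ • Ψ (g φ)‖ ≤ ∫ φ in s, ‖w φ • Ψ (g φ)‖ := norm_integral_le_integral_norm _
    _ ≤ ∫ φ in s, (Icc (-ℓ) ℓ).indicator (fun _ => W * M) φ :=
        integral_mono_of_nonneg (Eventually.of_forall fun _ => norm_nonneg _) (integrable_indicator_Icc_const_restrict ℓ (W * M) s)
          (Eventually.of_forall hpt)
    _ = (volume.restrict s (Icc (-ℓ) ℓ)).toReal * (W * M) := by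
        rw [integral_indicator_const _ measurableSet_Icc, smul_eq_mul, measureReal_def]
    _ ≤ (2 * ℓ) * (W * M) := by
        refine mul_le_mul_of_nonneg_right ?_ (mul_nonneg hW hM)
        refine ENNReal.toReal_le_of_le_ofReal (by positivity) ?_
        calc volume.restrict s (Icc (-ℓ) ℓ) ≤ volume (Icc (-ℓ) ℓ) := Measure.restrict_le_self _
          _ = ENNReal.ofReal (2 * ℓ) := by rw [Real.volume_Icc]; congr 1; ring
    _ = W * M * (2 * ℓ) := by ring

/-- **THE WINDOW LAW (interval currency)**: the same bound for `‖∫_{α..β} w φ • Ψ(g φ) dφ‖`, any `α, β`. [folklore] -/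
theorem norm_intervalIntegral_smul_comp_le_fold (ha : 0 < a) (hC : 0 ≤ C) (hwin : C * φ₀ ≤ a / 2)
    (hlow : ∀ φ, |φ| ≤ φ₀ → a * φ ^ 2 - C * |φ| ^ 3 - η ≤ |g φ|)
    (hΨ0 : ∀ y, ε < |y| → Ψ y = 0) (hΨM : ∀ y, ‖Ψ y‖ ≤ M) (hM : 0 ≤ M)
    (hw0 : ∀ φ, φ₀ < |φ| → w φ = 0) (hwW : ∀ φ, |φ| ≤ φ₀ → φ ^ 2 ≤ 2 * (ε + η) / a → |w φ| ≤ W) (hW : 0 ≤ W) (α β : ℝ) :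
    ‖∫ φ in α..β, w φ • Ψ (g φ)‖ ≤ W * M * (2 * Real.sqrt (2 * (ε + η) / a)) := by
  rw [intervalIntegral_eq_integral_uIoc, norm_smul]
  have h1 : ‖(if α ≤ β then (1 : ℝ) else -1)‖ = 1 := by split_ifs <;> simp
  rw [h1, one_mul]
  exact norm_setIntegral_smul_comp_le_fold ha hC hwin hlow hΨ0 hΨM hM hw0 hwW hW _

/-- **CROSSING-REGION READING OF A WEIGHT**: if `|w φ| ≤ ω (φ²)` on the window with `ω` monotone, then on the crossing region `|w φ| ≤ ω (2(ε+η)/a)` —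
the form in which `hwW` above is discharged for anisotropy weights `|𝒜|^i ≲ (|e| + φ² + δ)^i`. [folklore] -/
theorem weight_le_on_crossing_region {ω : ℝ → ℝ} (hω : Monotone ω) (hw : ∀ φ, |φ| ≤ φ₀ → |w φ| ≤ ω (φ ^ 2))
    (φ : ℝ) (hφ : |φ| ≤ φ₀) (hsq : φ ^ 2 ≤ 2 * (ε + η) / a) : |w φ| ≤ ω (2 * (ε + η) / a) :=
  (hw φ hφ).trans (hω hsq)

end Window

/-! ## §3 Layered shells: a slice function with tails as a finite sum of indicator shells -/

section Layered

variable {g w : ℝ → ℝ} {a C η φ₀ W : ℝ} {Ψ : ℝ → E} {N : ℕ} {εs Ms : ℕ → ℝ}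

/-- Pointwise domination by a sum of interval indicators when `‖Ψ y‖ ≤ Σ_{j<N} M_j·𝟙{|y| ≤ ε_j}` and `|w| ≤ W` on the whole window. [folklore] -/
theorem norm_smul_comp_le_sum_indicator_fold (ha : 0 < a) (hC : 0 ≤ C) (hwin : C * φ₀ ≤ a / 2)
    (hlow : ∀ φ, |φ| ≤ φ₀ → a * φ ^ 2 - C * |φ| ^ 3 - η ≤ |g φ|)
    (hΨ : ∀ y, ‖Ψ y‖ ≤ ∑ j ∈ Finset.range N, if |y| ≤ εs j then Ms j else 0) (hMs : ∀ j, 0 ≤ Ms j)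
    (hw0 : ∀ φ, φ₀ < |φ| → w φ = 0) (hwW : ∀ φ, |φ| ≤ φ₀ → |w φ| ≤ W) (hW : 0 ≤ W) (φ : ℝ) :
    ‖w φ • Ψ (g φ)‖ ≤ ∑ j ∈ Finset.range N, (Icc (-Real.sqrt (2 * (εs j + η) / a)) (Real.sqrt (2 * (εs j + η) / a))).indicator (fun _ => W * Ms j) φ := by
  have hnn : ∀ j, 0 ≤ (Icc (-Real.sqrt (2 * (εs j + η) / a)) (Real.sqrt (2 * (εs j + η) / a))).indicator (fun _ => W * Ms j) φ :=
    fun j => Set.indicator_nonneg (fun _ _ => mul_nonneg hW (hMs j)) _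
  by_cases hφ : |φ| ≤ φ₀
  · rw [norm_smul, Real.norm_eq_abs]
    calc |w φ| * ‖Ψ (g φ)‖ ≤ W * ∑ j ∈ Finset.range N, (if |g φ| ≤ εs j then Ms j else 0) :=
          mul_le_mul (hwW φ hφ) (hΨ _) (norm_nonneg _) hW
      _ = ∑ j ∈ Finset.range N, W * (if |g φ| ≤ εs j then Ms j else 0) := Finset.mul_sum _ _ _
      _ ≤ _ := Finset.sum_le_sum fun j _ => ?_
    by_cases hε : |g φ| ≤ εs j
    · have hmem : φ ∈ Icc (-Real.sqrt (2 * (εs j + η) / a)) (Real.sqrt (2 * (εs j + η) / a)) :=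
        abs_le.1 (abs_le_sqrt_of_fold_lower ha hC hwin hlow hφ hε)
      rw [if_pos hε, Set.indicator_of_mem hmem]
    · rw [if_neg hε, mul_zero]; exact hnn j
  · rw [hw0 _ (not_le.1 hφ), zero_smul, norm_zero]
    exact Finset.sum_nonneg fun j _ => hnn j

/-- **LAYERED WINDOW LAW**: `‖Ψ y‖ ≤ Σ_{j<N} M_j·𝟙{|y| ≤ ε_j}` (`M_j ≥ 0`), `|w| ≤ W` on the window, `w = 0` off it ⟹ for every set `s`,
`‖∫_s w φ • Ψ(g φ) dφ‖ ≤ W · Σ_{j<N} M_j · 2√(2(ε_j + η)/a)`. [folklore] -/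
theorem norm_setIntegral_smul_comp_le_fold_layered (ha : 0 < a) (hC : 0 ≤ C) (hwin : C * φ₀ ≤ a / 2)
    (hlow : ∀ φ, |φ| ≤ φ₀ → a * φ ^ 2 - C * |φ| ^ 3 - η ≤ |g φ|)
    (hΨ : ∀ y, ‖Ψ y‖ ≤ ∑ j ∈ Finset.range N, if |y| ≤ εs j then Ms j else 0) (hMs : ∀ j, 0 ≤ Ms j)
    (hw0 : ∀ φ, φ₀ < |φ| → w φ = 0) (hwW : ∀ φ, |φ| ≤ φ₀ → |w φ| ≤ W) (hW : 0 ≤ W) (s : Set ℝ) :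
    ‖∫ φ in s, w φ • Ψ (g φ)‖ ≤ W * ∑ j ∈ Finset.range N, Ms j * (2 * Real.sqrt (2 * (εs j + η) / a)) := by
  have hpt := norm_smul_comp_le_sum_indicator_fold ha hC hwin hlow hΨ hMs hw0 hwW hW
  have hint : ∀ j ∈ Finset.range N, Integrable
      ((Icc (-Real.sqrt (2 * (εs j + η) / a)) (Real.sqrt (2 * (εs j + η) / a))).indicator fun _ : ℝ => W * Ms j) (volume.restrict s) :=
    fun j _ => integrable_indicator_Icc_const_restrict _ _ s
  calc ‖∫ φ in s, w φ • Ψ (g φ)‖ ≤ ∫ φ in s, ‖w φ • Ψ (g φ)‖ := norm_integral_le_integral_norm _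
    _ ≤ ∫ φ in s, ∑ j ∈ Finset.range N, (Icc (-Real.sqrt (2 * (εs j + η) / a)) (Real.sqrt (2 * (εs j + η) / a))).indicator (fun _ => W * Ms j) φ :=
        integral_mono_of_nonneg (Eventually.of_forall fun _ => norm_nonneg _) (integrable_finsetSum _ hint) (Eventually.of_forall hpt)
    _ = ∑ j ∈ Finset.range N, ∫ φ in s, (Icc (-Real.sqrt (2 * (εs j + η) / a)) (Real.sqrt (2 * (εs j + η) / a))).indicator (fun _ => W * Ms j) φ :=
        integral_finsetSum _ hint
    _ ≤ ∑ j ∈ Finset.range N, W * (Ms j * (2 * Real.sqrt (2 * (εs j + η) / a))) := Finset.sum_le_sum fun j _ => ?_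
    _ = W * ∑ j ∈ Finset.range N, Ms j * (2 * Real.sqrt (2 * (εs j + η) / a)) := (Finset.mul_sum _ _ _).symm
  set ℓ := Real.sqrt (2 * (εs j + η) / a) with hℓ
  have hℓ0 : 0 ≤ ℓ := Real.sqrt_nonneg _
  rw [integral_indicator_const _ measurableSet_Icc, smul_eq_mul, measureReal_def]
  calc (volume.restrict s (Icc (-ℓ) ℓ)).toReal * (W * Ms j) ≤ (2 * ℓ) * (W * Ms j) := by
        refine mul_le_mul_of_nonneg_right ?_ (mul_nonneg hW (hMs j))
        refine ENNReal.toReal_le_of_le_ofReal (by positivity) ?_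
        calc volume.restrict s (Icc (-ℓ) ℓ) ≤ volume (Icc (-ℓ) ℓ) := Measure.restrict_le_self _
          _ = ENNReal.ofReal (2 * ℓ) := by rw [Real.volume_Icc]; congr 1; ring
    _ = W * (Ms j * (2 * ℓ)) := by ring

end Layered

end Summit.HubbardSuperconductivity.HubbardSuperconductivity.Theorems.C4a

end
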